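import Literature.NumberTheory.Automorphic.UnitaryGroupDoubledSiegelSquares
import Literature.NumberTheory.Automorphic.UnitaryGroupArchimedeanPlaces
import Literature.LinearAlgebra.Matrix.GeneralLinearGroupSquaresPi
import HarnessLib

/-!
# The archimedean Siegel parabolic `P_Δ(L⁺ ⊗ ℝ)` of the doubled unitary group: every element is a product of squares

Topic `NumberTheory/Automorphic`; namespace `Literature.NumberTheory.Automorphic` (sub-namespaces `GLn`,
`UnitaryGroup`).  KERNEL only: proved theorems, no definition, no named fact, no `sorry`.

For a totally complex number field `E` (e.g. a CM field), `E ⊗_ℚ ℝ = mixedSpace E ≅ ∏_{w} ℂ` and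

* `GLn.closure_isSquare_eq_top_mixedSpace` — `GL_ι(E ⊗ ℝ)` is generated by squares (`GL_n(ℂ)` is:
  `GeneralLinearGroup.closure_isSquare_eq_top_of_isAlgClosed`, [Artin1988, Chap. IV Thm. 4.6]; transported along
  `M_ι(∏ ℂ) ≅ ∏ M_ι(ℂ)` by `GeneralLinearGroupSquaresPi`);
* `UnitaryGroup.isSiegelReindex_ofInfinite_iff` — the Siegel condition `P_Δ` (`DoubledUnitary.IsSiegelReindex e`, GR-2's
  `IsSiegelDelta`) for the adelic point `(g, 1) = GLn.ofInfinite g ∈ GL_N(𝔸_E)` is the Siegel condition for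
  `g ∈ GL_N(E ⊗ ℝ)` (the finite component `1` lies in `P_Δ`);
* **`UnitaryGroup.exists_list_sq_of_isSiegel_archToAdelic`** (and `…_of_base` for a form `(reindex e e (T ⊕ −T)) ⊗ 1`
  defined over `F`, the literal shape of GR-2's `hermD`) — for an involution `c` of `E/F`, `S₀ ∈ M_ι(E)` symmetric
  `c`-fixed of unit determinant and `J = reindex e e (S₀ ⊕ −S₀)` (the doubled hermitian form, e.g. GR-2's `hermD`):
  every `g ∈ U(J)(E ⊗ ℝ) = UnitaryGroup.arch F E c N J` whose adelic image `archToAdelic g` lies in `P_Δ(𝔸)` is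
  `(l.map (q ↦ q²)).prod` for a list `l` of elements of `U(J)(E ⊗ ℝ)` with `archToAdelic q ∈ P_Δ(𝔸)` —
  [HarrisKudlaSweet1996, §1 (1.11)–(1.12)]: `P_Δ(E ⊗ ℝ) ≅ ∏_w GL_n(ℂ) ⋉ Herm_n(ℂ)` via the ring-level Levi ∕ unipotent
  factorisation of `UnitaryGroupDoubledSiegelSquares`.

This is input U3 of the archimedean half `stub_S1arch` of the kernel construction of [GelbartRogawski1991, Prop. 3.1.1]
(stage-1 cell `pub-hodgecm`, seat GR-3 `stub_S1arch_squares`): with `F = L⁺`, `E = L` CM, `c` = complex conjugation,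
`N = n + n`, `e = finSumFinEquiv`, `S₀ = gramR ⊗ 1`, `J = hermD`, it says that every `{±1}`-valued multiplicative
function on `P_Δ(L⁺ ⊗ ℝ)` is trivial.

## References

* M. Harris, S. S. Kudla, W. J. Sweet, J. Amer. Math. Soc. 9 (1996), §1 (1.9)–(1.12) [HarrisKudlaSweet1996].
* E. Artin, *Geometric Algebra*, Chap. IV Thm. 4.6 [Artin1988].
* A. Borel, H. Jacquet, PSPM 33.1 (1979), §4.1 (archimedean and adelic points) [BorelJacquet1979].
-/

set_option autoImplicit false

noncomputable section

open NumberField NumberField.mixedEmbedding NumberField.InfinitePlace IsDedekindDomain Matrix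
open scoped MatrixGroups

namespace Literature.NumberTheory.Automorphic

/-! ## 1. `GL_ι(E ⊗ ℝ)` is generated by squares for `E` totally complex -/

section MixedSpace

variable (K : Type*) [Field K] [NumberField K] {ι : Type*} [Fintype ι] [DecidableEq ι]

/-- **`GL_ι(K ⊗_ℚ ℝ)` is generated by squares for a totally complex number field `K`** (`K ⊗ ℝ ≅ ℝ^0 × ℂ^{r₂}`; each
`GL_ι(ℂ)` is generated by squares, and the property passes to finite products of rings).
[cite: Artin1988, Chap. IV Thm. 4.6] -/
theorem GLn.closure_isSquare_eq_top_mixedSpace [IsTotallyComplex K] :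
    Subgroup.closure {g : GL ι (mixedSpace K) | IsSquare g} = ⊤ := by
  classical
  refine Literature.LinearAlgebra.Matrix.GeneralLinearGroup.closure_isSquare_eq_top_prod ?_ ?_
  · exact Literature.LinearAlgebra.Matrix.GeneralLinearGroup.closure_isSquare_eq_top_pi _ fun w =>
      absurd w.2 (InfinitePlace.not_isReal_iff_isComplex.2 (IsTotallyComplex.isComplex w.1))
  · exact Literature.LinearAlgebra.Matrix.GeneralLinearGroup.closure_isSquare_eq_top_pi _ fun _ =>
      Literature.LinearAlgebra.Matrix.GeneralLinearGroup.closure_isSquare_eq_top_of_isAlgClosed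

end MixedSpace

/-! ## 2. The Siegel condition for `(g, 1) ∈ GL_N(𝔸_E)` is the Siegel condition for `g ∈ GL_N(E ⊗ ℝ)` -/

section Siegel

variable {R S : Type*} [CommRing R] [CommRing S] {ι : Type*} {m : Type*} (e : ι ⊕ ι ≃ m)

/-- the Siegel block sums commute with an entrywise ring homomorphism. [folklore] -/
private theorem siegelBlocks_map (f : R →+* S) (M : Matrix m m R) :
    (Matrix.reindex e.symm e.symm (M.map f)).toBlocks₁₁ + (Matrix.reindex e.symm e.symm (M.map f)).toBlocks₁₂ =
        ((Matrix.reindex e.symm e.symm M).toBlocks₁₁ + (Matrix.reindex e.symm e.symm M).toBlocks₁₂).map f ∧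
      (Matrix.reindex e.symm e.symm (M.map f)).toBlocks₂₁ + (Matrix.reindex e.symm e.symm (M.map f)).toBlocks₂₂ =
        ((Matrix.reindex e.symm e.symm M).toBlocks₂₁ + (Matrix.reindex e.symm e.symm M).toBlocks₂₂).map f := by
  constructor <;>
  · rw [Matrix.map_add f (map_add f)]
    rfl

/-- the identity lies in `P_Δ`. [folklore] -/
private theorem siegelBlocks_one [DecidableEq ι] [DecidableEq m] :
    (Matrix.reindex e.symm e.symm (1 : Matrix m m R)).toBlocks₁₁ + (Matrix.reindex e.symm e.symm (1 : Matrix m m R)).toBlocks₁₂ =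
      (Matrix.reindex e.symm e.symm (1 : Matrix m m R)).toBlocks₂₁ +
        (Matrix.reindex e.symm e.symm (1 : Matrix m m R)).toBlocks₂₂ := by
  rw [Matrix.reindex_apply, Equiv.symm_symm, Matrix.submatrix_one_equiv, ← Matrix.fromBlocks_one,
    Matrix.toBlocks_fromBlocks₁₁, Matrix.toBlocks_fromBlocks₁₂, Matrix.toBlocks_fromBlocks₂₁, Matrix.toBlocks_fromBlocks₂₂,
    add_zero, zero_add]

/-- base change of a re-enumerated doubled form: `(reindex e e (T ⊕ −T)) ⊗ 1 = reindex e e (T ⊗ 1 ⊕ −(T ⊗ 1))`.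
[cite: HarrisKudlaSweet1996, §1 (1.9)] -/
theorem reindex_fromBlocks_neg_map [Fintype ι] [DecidableEq ι] (f : R →+* S) (T : Matrix ι ι R) :
    (Matrix.reindex e e (Matrix.fromBlocks T 0 0 (-T))).map f =
      Matrix.reindex e e (Matrix.fromBlocks (T.map f) 0 0 (-(T.map f))) := by
  rw [Matrix.reindex_apply, Matrix.reindex_apply, ← Matrix.submatrix_map, Matrix.fromBlocks_map,
    Matrix.map_zero (⇑f) (map_zero f), Matrix.map_neg (⇑f) (map_neg f)]

end Siegel

namespace UnitaryGroup

section OfInfinite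

variable (E : Type) [Field E] [NumberField E] (N : ℕ) {ι : Type*} (e : ι ⊕ ι ≃ Fin N)

/-- **`(g, 1) ∈ P_Δ(𝔸_E) ↔ g ∈ P_Δ(E ⊗ ℝ)`**: the Siegel condition for the adelic point `GLn.ofInfinite g` is the Siegel
condition for `g` (archimedean part: transport along `E_∞ ≅ E ⊗ ℝ`; finite part: `1 ∈ P_Δ`).
[cite: BorelJacquet1979, §4.1] -/
theorem isSiegelReindex_ofInfinite_iff (g : GL (Fin N) (mixedSpace E)) :
    DoubledUnitary.IsSiegelReindex e (GLn.ofInfinite N E g) ↔ DoubledUnitary.IsSiegelReindex e g := by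
  classical
  set ε := InfiniteAdeleRing.ringEquiv_mixedSpace E with hε
  have hfst : Matrix.GeneralLinearGroup.map (adeleFst E) (GLn.ofInfinite N E g) =
      Matrix.GeneralLinearGroup.map ε.symm.toRingHom g :=
    Units.ext (map_fst_ofInfinite E N g)
  have hback : Matrix.GeneralLinearGroup.map ε.toRingHom (Matrix.GeneralLinearGroup.map ε.symm.toRingHom g) = g := by
    refine Units.ext ?_
    change ((g : Matrix (Fin N) (Fin N) (mixedSpace E)).map ε.symm.toRingHom).map ε.toRingHom = _
    rw [Matrix.map_map]
    have : (⇑ε.toRingHom ∘ ⇑ε.symm.toRingHom : mixedSpace E → mixedSpace E) = id := funext fun x => ε.apply_symm_apply x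
    rw [this, Matrix.map_id]
  constructor
  · intro hG
    have h1 := hG.map e (adeleFst E)
    rw [hfst] at h1
    have h2 := h1.map e ε.toRingHom
    rwa [hback] at h2
  · intro hg
    -- archimedean part: transport of `hg`; finite part: the identity
    have harch := hg.map e ε.symm.toRingHom
    rw [← hfst] at harch
    unfold DoubledUnitary.IsSiegelReindex at harch ⊢
    have hGfst : ((Matrix.GeneralLinearGroup.map (adeleFst E) (GLn.ofInfinite N E g) : GL (Fin N) (InfiniteAdeleRing E)) :
        Matrix (Fin N) (Fin N) (InfiniteAdeleRing E)) =
        ((GLn.ofInfinite N E g : GL (Fin N) (AdeleRing (𝓞 E) E)) : Matrix (Fin N) (Fin N) (AdeleRing (𝓞 E) E)).map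
          (adeleFst E) := rfl
    rw [hGfst, (siegelBlocks_map e (adeleFst E) _).1, (siegelBlocks_map e (adeleFst E) _).2] at harch
    have hsnd : ((GLn.ofInfinite N E g : GL (Fin N) (AdeleRing (𝓞 E) E)) : Matrix (Fin N) (Fin N) (AdeleRing (𝓞 E) E)).map
        (adeleSnd E) = 1 := map_snd_ofInfinite E N g
    have hfin := siegelBlocks_one (R := FiniteAdeleRing (𝓞 E) E) e
    rw [← hsnd, (siegelBlocks_map e (adeleSnd E) _).1, (siegelBlocks_map e (adeleSnd E) _).2] at hfin
    exact Matrix.ext fun i j => Prod.ext (congrFun (congrFun harch i) j) (congrFun (congrFun hfin i) j)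

end OfInfinite

/-! ## 3. `P_Δ(E ⊗ ℝ)`: every element is a product of squares of elements of `P_Δ(E ⊗ ℝ)` -/

section Arch

variable (F E : Type) [Field F] [NumberField F] [Field E] [NumberField E] [Algebra F E] (c : E ≃ₐ[F] E) (N : ℕ)
  (J : Matrix (Fin N) (Fin N) E) {ι : Type*} [Fintype ι] [DecidableEq ι] (e : ι ⊕ ι ≃ Fin N)

omit [NumberField F] [NumberField E] in
/-- `(c ⊗ 1)² = 1` on `E ⊗ ℝ` for an involution `c` (from the tree's `conjMixed_inv_apply`). [folklore] -/
private theorem conjMixed_conjMixed' (hc : ∀ x, c (c x) = x) (x : mixedSpace E) :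
    conjMixed F E c (conjMixed F E c x) = x := by
  have hcc : c * c = 1 := AlgEquiv.ext fun y => by rw [AlgEquiv.mul_apply, hc]; rfl
  have hinv : c⁻¹ = c := inv_eq_of_mul_eq_one_right hcc
  have h := conjMixed_inv_apply F E c x
  rwa [hinv] at h

/-- **Every element of `P_Δ(E ⊗ ℝ)` is a product of squares of elements of `P_Δ(E ⊗ ℝ)`.**  Let `E` be totally complex,
`c` an involution of `E/F`, `S₀ ∈ M_ι(E)` symmetric, `c`-fixed, of unit determinant, and `J = reindex e e (S₀ ⊕ −S₀)` the
doubled hermitian form.  Then every `g ∈ U(J)(E ⊗ ℝ)` with `archToAdelic g ∈ P_Δ(𝔸)` (`DoubledUnitary.IsSiegelReindex e`)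
is `(l.map (q ↦ q * q)).prod` for a list `l` of elements `q ∈ U(J)(E ⊗ ℝ)` with `archToAdelic q ∈ P_Δ(𝔸)` —
`P_Δ(E ⊗ ℝ) ≅ ∏_w GL_n(ℂ) ⋉ Herm_n(ℂ)`, `m(a) n(b) = (∏ m(sᵢ)²) · n(b/2)²`. [cite: HarrisKudlaSweet1996, §1 (1.11)–(1.12)] -/
theorem exists_list_sq_of_isSiegel_archToAdelic [IsTotallyComplex E] (hc : ∀ x, c (c x) = x)
    {S₀ : Matrix ι ι E} (hS₀c : S₀.map (c : E →+* E) = S₀) (hS₀s : S₀ᵀ = S₀) (hS₀u : IsUnit S₀.det)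
    (hJ : J = Matrix.reindex e e (Matrix.fromBlocks S₀ 0 0 (-S₀)))
    (g : arch F E c N J)
    (hg : DoubledUnitary.IsSiegelReindex e
      ((archToAdelic F E c N J g).1 : GL (Fin N) (AdeleRing (𝓞 E) E))) :
    ∃ l : List (arch F E c N J),
      (∀ q ∈ l, DoubledUnitary.IsSiegelReindex e
        ((archToAdelic F E c N J q).1 : GL (Fin N) (AdeleRing (𝓞 E) E))) ∧
      g = (l.map fun q => q * q).prod := by
  -- the data of `UnitaryGroupDoubledSiegelSquares` over `R = E ⊗ ℝ`, `σ = c ⊗ 1`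
  set S : Matrix ι ι (mixedSpace E) := S₀.map (mixedEmbedding E) with hS
  have hσ : ∀ x, conjMixed F E c (conjMixed F E c x) = x := conjMixed_conjMixed' F E c hc
  have h2 : IsUnit (2 : mixedSpace E) := by
    have : (2 : mixedSpace E) = algebraMap ℝ (mixedSpace E) 2 := by rw [map_ofNat]
    rw [this]
    exact (isUnit_iff_ne_zero.2 two_ne_zero).map _
  have hSσ : S.map (conjMixed F E c) = S := by
    rw [hS, Matrix.map_map]
    have : (⇑(conjMixed F E c) ∘ ⇑(mixedEmbedding E) : E → mixedSpace E) = ⇑(mixedEmbedding E) ∘ ⇑(c : E →+* E) :=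
      funext fun x => conjMixed_mixedEmbedding F E c x
    rw [this, ← Matrix.map_map, hS₀c]
  have hSs : Sᵀ = S := by rw [hS, ← Matrix.transpose_map, hS₀s]
  have hSu : IsUnit S.det := by
    rw [hS, ← RingHom.mapMatrix_apply, ← RingHom.map_det]
    exact hS₀u.map _
  have hGL := GLn.closure_isSquare_eq_top_mixedSpace E (ι := ι)
  have hJ' : archFormOf E N J = Matrix.reindex e e (Matrix.fromBlocks S 0 0 (-S)) := by
    rw [archFormOf, hJ, reindex_fromBlocks_neg_map, ← hS]
  -- the Siegel condition of `archToAdelic q = (q, 1)` is that of `q`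
  have hiff : ∀ q : arch F E c N J, DoubledUnitary.IsSiegelReindex e
      ((archToAdelic F E c N J q).1 : GL (Fin N) (AdeleRing (𝓞 E) E)) ↔
        DoubledUnitary.IsSiegelReindex e (q : GL (Fin N) (mixedSpace E)) :=
    fun q => isSiegelReindex_ofInfinite_iff E N e (q : GL (Fin N) (mixedSpace E))
  obtain ⟨l, hl, hgl⟩ := DoubledUnitary.exists_list_sq_of_isSiegelReindex (conjMixed F E c) e hσ h2 hSσ hSs hSu hGL
    (archFormOf E N J) hJ' g ((hiff g).1 hg)
  exact ⟨l, fun q hq => (hiff q).2 (hl q hq), hgl⟩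

/-- **The same, for a doubled form defined over the base field** — the shape of GR-2's `hermD = (reindex e₂ e₂ (T ⊕ −T)) ⊗ 1`
with `T = gramR ∈ M_n(L⁺)` symmetric of unit determinant: every `g ∈ U(J)(E ⊗ ℝ)` with `archToAdelic g ∈ P_Δ(𝔸)` is a
product of squares of such elements.  (For `stub_S1arch_squares`: `F := L⁺`, `E := L`, `c :=` complex conjugation,
`T := gramR`, `e := finSumFinEquiv`, `hJ := rfl`.) [cite: HarrisKudlaSweet1996, §1 (1.11)–(1.12)] -/
theorem exists_list_sq_of_isSiegel_archToAdelic_of_base [IsTotallyComplex E] (hc : ∀ x, c (c x) = x)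
    {T : Matrix ι ι F} (hTs : Tᵀ = T) (hTu : IsUnit T.det)
    (hJ : J = (Matrix.reindex e e (Matrix.fromBlocks T 0 0 (-T))).map (algebraMap F E))
    (g : arch F E c N J)
    (hg : DoubledUnitary.IsSiegelReindex e ((archToAdelic F E c N J g).1 : GL (Fin N) (AdeleRing (𝓞 E) E))) :
    ∃ l : List (arch F E c N J),
      (∀ q ∈ l, DoubledUnitary.IsSiegelReindex e ((archToAdelic F E c N J q).1 : GL (Fin N) (AdeleRing (𝓞 E) E))) ∧
      g = (l.map fun q => q * q).prod := by
  refine exists_list_sq_of_isSiegel_archToAdelic F E c N J e hc (S₀ := T.map (algebraMap F E)) ?_ ?_ ?_ ?_ g hg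
  · rw [Matrix.map_map]
    have : (⇑(c : E →+* E) ∘ ⇑(algebraMap F E) : F → E) = ⇑(algebraMap F E) := funext fun x => c.commutes x
    rw [this]
  · rw [← Matrix.transpose_map, hTs]
  · rw [← RingHom.mapMatrix_apply, ← RingHom.map_det]
    exact hTu.map _
  · rw [hJ, reindex_fromBlocks_neg_map]

end Arch

end UnitaryGroup

end Literature.NumberTheory.Automorphic
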